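import Mathlib
import HarnessLib
import Summits.HubbardSuperconductivity.HubbardSuperconductivity.Theorems.KLProgrammeKLRegimeTwoVolumeTowerDataTSWExistsH0
import Summits.HubbardSuperconductivity.HubbardSuperconductivity.Theorems.KLProgrammeKLRegimeTwoVolumeTowerDataTSWOfReadoutsH0WA

/-!
# Route `KLProgramme` — crux K3, VL child `KLRegimeVolumeLimitV17F3` (stmt-HubbardSuperconductivity-23356), cure of LR13′ «(VL)-HUV-CURRENCY-PROPAGATION»,
# consumer step C2b′ (cure (c1) of «(VL)-HE1-LEVEL0-DEG2»): `∃ t ∈ (0,1], Nonempty (TowerDataTSW β U μ t)` WITH TOKEN #24-W AND E1's DEGREE-2 LAW AT `εb`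
# (twin of `…TowerDataTSWExistsH0W.exists_towerDataTSW_of_readoutsH0W`; seat hubbard-kl-k3c4-p1 g20; `--supports` 23356)

Byte-identical to `exists_towerDataTSW_of_readoutsH0` except that the two token-#24 clauses of `hinst` read `SourceProfilesAtLevF … (srcWindowFamily _ M) …` and
the constructor is `…TowerDataTSWOfReadoutsH0W.towerDataTSW_of_readoutsH0W` (no `ℓ¹` rows of the smoothing kernel; the free real `Cw` is kept in the
scale-free inequalities so that every caller's arithmetic is unchanged).

* **`exists_towerDataTSW_of_readoutsH0WA`** (alive law only in degrees `≥ 4`; `hS₀two` at `εb`; `hsmall` at `εb` with `2K`).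

Proofs only; no definition.  Honest framing: a conditional constructor; nothing here asserts `h0T`, the read-outs, any stub, K3, VL or superconductivity.
[cite: BenfattoGiulianiMastropietro2006, §2.7-§2.9 and §3]
-/

noncomputable section

namespace Summit.HubbardSuperconductivity.HubbardSuperconductivity.Theorems.TwoVolumeSource

set_option linter.dupNamespace false -- summit = problem name (single-conjunct summit), D-0017

open Finset Filter Topology Literature.MathematicalPhysics.QuantumLattice GrassmannAlgebra Literature.Probability.LatticeModels
  Literature.Probability.LatticeModels.BattleFederbush
open Summit.HubbardSuperconductivity.HubbardSuperconductivity.Theorems.KLRegimeSplit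
open Summit.HubbardSuperconductivity.HubbardSuperconductivity.Theorems.KLProgrammeLegKernels
open Summit.HubbardSuperconductivity.HubbardSuperconductivity.Theorems.TwoPointAssembly
open Summit.HubbardSuperconductivity.HubbardSuperconductivity.Theorems.EngineV8
open Summit.HubbardSuperconductivity.HubbardSuperconductivity.Theorems.TwoVolumeDefect

set_option maxHeartbeats 800000 in -- one large application
/-- **`∃ t ∈ (0,1], Nonempty (TowerDataTSW β U μ t)` FROM THE SUPPLIERS' READ-OUTS, token #24 in the WINDOWED currency** (see the module docstring).
[folklore: composition; cite: BenfattoGiulianiMastropietro2006, §2.7-§2.9 and §3] -/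
theorem exists_towerDataTSW_of_readoutsH0WA (β U μ : ℝ) (hβ : 0 < β) (Cw : ℝ) (P : SplitConsts) (Q Q' : EngConsts) (hCE : 0 < Q.CE) (hCE' : 0 ≤ Q'.CE) (hKl : 0 ≤ P.Klam)
    (A : ℕ → ℕ → ℝ) (hA : ∀ j s, 0 ≤ A j s)
    (Mth : ℕ → ℕ → ℕ)
    -- constants and laws
    (Λ ΛT κ κf aW sW eW' cW cRb cCb δb : ℕ → ℝ) (sE cR cC δ : ℕ → ℕ → ℝ) (r : ℕ → ℕ) (k₀ a₀ cR₀ cC₀ kf cW₀ δb₀ r₀ C₀ εb : ℝ)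
    (hΛ : ∀ j, 0 < Λ j) (hΛmono : ∀ j, Λ (j + 1) ≤ Λ j) (hΛT : ∀ j, Λ j ≤ ΛT j) (hΛr : ∀ j, j ≤ nScales β → Λ j ≤ klScale klE0 (r j))
    (hk₀ : 0 < k₀) (hκ : ∀ j, 0 < κ j) (hκ2 : ∀ j, κ j ^ 2 = k₀ ^ 2 * ((8 : ℝ) ^ j)⁻¹) (hκfge : ∀ j, κ j ≤ κf j) (hκf : ∀ j, κf j ≤ kf * κ j)
    (hkf : 1 ≤ kf) (haW0 : ∀ j, 0 ≤ aW j) (haW : ∀ j, aW j ≤ a₀ * 4 ^ j) (hsW : ∀ j, 0 ≤ sW j) (heW' : ∀ j, 0 ≤ eW' j)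
    (hcW1 : ∀ j, 1 ≤ cW j) (hcW : ∀ j, cW j ≤ cW₀) (hcRb0 : ∀ j, 0 ≤ cRb j) (hcRb : ∀ j, cRb j ≤ cR₀) (hcCb0 : ∀ j, 0 ≤ cCb j) (hcCb : ∀ j, cCb j ≤ cC₀)
    (hδb0 : ∀ j, 0 ≤ δb j) (hδb : ∀ j, δb j ≤ δb₀) (hr₀0 : 0 ≤ r₀) (hr₀ : 8 * Real.exp 2 * (kf + 1) * (cW₀ + δb₀ + 1) ≤ r₀) (hC₀ : 0 ≤ C₀)
    -- E1's alive budgets with their law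
    (S₀ : ℕ → ℕ → ℝ) (hS₀0 : ∀ j m, 0 ≤ S₀ j m) (hS₀law : ∀ j, j ≤ nScales β → ∀ m, 2 ≤ m → S₀ j (2 * m) ≤ C₀ * klWtBudget P Q U (j + 1) (2 * m))
    (hS₀two : ∀ j, j ≤ nScales β → S₀ j 2 ≤ C₀ * Q.CE * εb * ((4 : ℝ) ^ (j + 1))⁻¹)
    -- the four scale-free inequalities on `ε_{j+1}`, `j ≤ n_β`
    (hε : ∀ j, j ≤ nScales β → 0 < epsCoupling P U (j + 1)) (hεb : ∀ j, j ≤ nScales β → epsCoupling P U (j + 1) ≤ εb)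
    (hεq : ∀ j, j ≤ nScales β → 8 * Q.CE * ((max 1 Cw) ^ 2 * (2 * Real.exp 2 ^ 2 * (1 + r₀) ^ 2 * k₀ ^ 2)) * epsCoupling P U (j + 1) ≤ 1)
    (hεq' : ∀ j, j ≤ nScales β → 8 * Q'.CE * ((max 1 Cw) ^ 2 * (2 * Real.exp 2 ^ 2 * (1 + r₀) ^ 2 * k₀ ^ 2)) * epsCoupling P U (j + 1) ≤ 1)
    (hsmall : ∀ j, j < nScales β → εb *
      (256 * Real.exp 1 ^ 2 * (a₀ + cR₀ + cC₀ + 1) * (42 * cW₀ + 4 * δb₀ + 8 * Real.exp 1) *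
        (2 * (Q.CE * ((max 1 Cw) ^ 2 * (2 * Real.exp 2 ^ 2 * (1 + r₀) ^ 2 * k₀ ^ 2)) / 4 *
          (C₀ * (1 + 8 * Q.CE * ((max 1 Cw) ^ 2 * (2 * Real.exp 2 ^ 2 * (1 + r₀) ^ 2 * k₀ ^ 2))) + 1 +
            εb * Q'.CE * (1 + 8 * Q'.CE * ((max 1 Cw) ^ 2 * (2 * Real.exp 2 ^ 2 * (1 + r₀) ^ 2 * k₀ ^ 2))) / 4)))) ≤ k₀ ^ 2)
    -- (H4) the mismatch rates
    (hmis : ∀ j L, 0 ≤ sE j L ∧ 0 ≤ cR j L ∧ 0 ≤ cC j L ∧ 0 ≤ δ j L ∧ cR j L ≤ cRb j ∧ cC j L ≤ cCb j ∧ δ j L ≤ δb j)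
    (hmis0 : ∀ j, Tendsto (sE j) atTop (𝓝 0) ∧ Tendsto (cR j) atTop (𝓝 0) ∧ Tendsto (cC j) atTop (𝓝 0) ∧ Tendsto (δ j) atTop (𝓝 0))
    -- (H5) the suppliers' conclusions at every admissible instance, eventually in `L`
    (hinst : ∀ᶠ L in atTop, ∀ (b M : ℕ) [NeZero L] [NeZero (b * L)] [NeZero M], Mth L b ≤ M →
      (∀ k, k ≤ nScales β → hubbardEffPartitionFnCT L M β U μ 0 (klFlowFrameU L M β U μ (nScales β + 1)) (klScale klE0 (k + 1)) ≠ 0) ∧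
      (∀ k, k ≤ nScales β → hubbardEffPartitionFnCT (b * L) M β U μ 0 (klFlowFrameU (b * L) M β U μ (nScales β + 1)) (klScale klE0 (k + 1)) ≠ 0) ∧
      (∀ j, j < nScales β → ScaleCovData (klStepCov L M β μ (klFlowFrameU L M β U μ (nScales β + 1)) j) (Λ j) (κ j) (aW j / imagTimeWeight β M) (sW j)) ∧
      (∀ j, j < nScales β →
        ScaleCovData (klStepCov (b * L) M β μ (klFlowFrameU (b * L) M β U μ (nScales β + 1)) j) (Λ j) (κ j) (aW j / imagTimeWeight β M) (sW j)) ∧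
      (∀ j, j ≤ nScales β → ∀ (m : ℕ) (q : Fin m) (w : SpaceTimeIdx L M × SectorLeg (sectorCount j)),
        klWtPinnedSumAt L M β μ (klFlowFrameU L M β U μ (nScales β + 1)) j (r j) m
          (klEffectiveAction L M β U μ (klFlowFrameU L M β U μ (nScales β + 1)) klE0 (j + 1)) q w ≤ S₀ j m) ∧
      (∀ j, j ≤ nScales β → ∀ (m : ℕ) (q : Fin m) (w : SpaceTimeIdx (b * L) M × SectorLeg (sectorCount j)),
        klWtPinnedSumAt (b * L) M β μ (klFlowFrameU (b * L) M β U μ (nScales β + 1)) j (r j) m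
          (klEffectiveAction (b * L) M β U μ (klFlowFrameU (b * L) M β U μ (nScales β + 1)) klE0 (j + 1)) q w ≤ S₀ j m) ∧
      (∀ j, j ≤ nScales β → SourceProfilesAtLevF L M (klSrcBudget P Q' U A (j + 1)) β U μ (klFlowFrameU L M β U μ (nScales β + 1))
        (srcWindowFamily L M) j (r j) (j + 1)) ∧
      (∀ j, j ≤ nScales β →
        SourceProfilesAtLevF (b * L) M (klSrcBudget P Q' U A (j + 1)) β U μ (klFlowFrameU (b * L) M β U μ (nScales β + 1))
          (srcWindowFamily (b * L) M) j (r j) (j + 1)) ∧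
      TowerCrossData L b M β μ (klFlowFrameU L M β U μ (nScales β + 1)) (klFlowFrameU (b * L) M β U μ (nScales β + 1)) (nScales β) (imagTimeWeight β M)
        Λ κ aW sW eW' ΛT cW κf (fun j => sE j L) (fun j => cR j L) (fun j => cC j L) (fun j => δ j L))
    -- (H6) the BASE as a hypothesis (located «BASE-SRC-ROWS», p3 g18: the transfer-row route to it is dead; any route may supply it): the TRUNCATED keyed
    -- defect of the step-`0` states at the `2r_L`-deep pins, canonical radius `r_L = L/(4J+7)`, tends to zero uniformly in the instance
    (h0T : ∀ (k : ℕ) (η : ℝ), 0 < η → ∀ᶠ L in atTop, ∀ (b M : ℕ) [NeZero L] [NeZero (b * L)] [NeZero M], Mth L b ≤ M →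
      ∀ (p : Fin k) (w : SrcLabel (b * L) M 0),
        (∀ i, 2 * (L / (4 * nScales β + 7)) ≤ (w.1.1.2 i).val % L ∧ (w.1.1.2 i).val % L + 2 * (L / (4 * nScales β + 7)) < L) →
        klKeyedDefectTSW L b M β U μ (klFlowFrameU L M β U μ (nScales β + 1)) (klFlowFrameU (b * L) M β U μ (nScales β + 1)) 1 0 k p w ≤ imagTimeWeight β M * η)
 :
    ∃ t : ℝ, 0 < t ∧ t ≤ 1 ∧ Nonempty (TowerDataTSW β U μ t) := by
  -- S1: the source scale against the targets `τ_j := klWtBudget P Q U (j+1) 2 = CE·ε_{j+1}·4^{-(j+1)} > 0`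
  have hτpos : ∀ j, j ≤ nScales β → 0 < klWtBudget P Q U (j + 1) 2 := fun j hj => by
    rw [klWtBudget_two_eq_inv_pow]
    have := hε j hj
    positivity
  obtain ⟨t, ht0, ht1, hτ⟩ := exists_srcScale_klSrcBudget_le P Q' U A (nScales β) (fun j => klWtBudget P Q U (j + 1) 2) hτpos
    (fun j s _ _ _ => hA (j + 1) s) (fun j m => klWtBudget_nonneg hCE' hKl U (j + 1) m)
  exact ⟨t, ht0, ht1, towerDataTSW_of_readoutsH0WA β U μ hβ Cw P Q Q' hCE.le hCE' hKl A hA ht0 ht1 hτ Mth Λ ΛT κ κf aW sW eW' cW cRb cCb δb sE cR cC δ r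
    k₀ a₀ cR₀ cC₀ kf cW₀ δb₀ r₀ C₀ εb hΛ hΛmono hΛT hΛr hk₀ hκ hκ2 hκfge hκf hkf haW0 haW hsW heW' hcW1 hcW hcRb0 hcRb hcCb0 hcCb hδb0 hδb hr₀0 hr₀ hC₀
    S₀ hS₀0 hS₀law hS₀two hε hεb hεq hεq' hsmall hmis hmis0 hinst
    h0T⟩

end Summit.HubbardSuperconductivity.HubbardSuperconductivity.Theorems.TwoVolumeSource

end
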